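import Literature.Analysis.FluidPDE.MollifiedNSRWeak
import Literature.Analysis.FluidPDE.MollifiedStartTripleBounds
import Literature.Analysis.FluidPDE.TorusPressureReconstruction
import Literature.Analysis.FluidPDE.NSRPerturbationVisc
import HarnessLib

/-!
# The reparametrised space–time mollification of a Navier–Stokes–Reynolds triple is again a
  Navier–Stokes–Reynolds triple on the same time interval

Analysis/FluidPDE support file (everything proved) for the mollification step of the intermittent
convex-integration scheme of Buckmaster–Vicol (Ann. of Math. 189 (2019), §4.1 (4.2)–(4.3); EMS Surv.
6 (2019), §7.3 (7.5)–(7.6)), in the form needed to iterate on a FIXED interval `[0, T]`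
(`Literature.Barriers.AnomalousDissipation.BuckmasterVicol2019_iterationFromLevel`): given a classical
triple `(v, p, R)` on `[0, T] × 𝕋^d`, its zero extensions `U`, `RU`, the mollified objects
`V = mollifiedField φ ε U`, `𝒯 = mollifiedFlux φ ε U`, `ℛ_ℓ = mollifiedStress φ ε RU` and the pressure
`q` of the residual (`∇q = ∂ₜV + div 𝒯 - νΔV - div ℛ_ℓ` on the window-interior times
`S₀ = (rOut, T - rOut)`, from `MollifiedNSRWeak` + `TorusPressureReconstruction`), and an affine time map
`τ(t) = κt + c` sending `[0, T']` into `S₀`, the triple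

* `ṽ(t) = V(τ t)`,
* `R̃(t) = (V ⊗ V - 𝒯 + ℛ_ℓ)˚(τ t) + ℛ[(κ - 1) ∂ₜV(τ t)]` (the reparametrisation defect
  `(κ - 1)∂ₜV`, of zero mean, is absorbed by the anti-divergence `ℛ = Torus.antidivergence`),
* `p̃(t) = -q(τ t) - tr(V ⊗ V - 𝒯 + ℛ_ℓ)(τ t)/d + mean`,

solves the NSR system with the same viscosity on `[0, T'] × 𝕋^d` (`Torus.isNSReynoldsOn_reparam`). With
`κ = 1` this is BV's `(v_ℓ, p_ℓ, R̊_ℓ + R̃_commutator)` read on a shifted window; `κ = 1 - 4ℓ/T`,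
`c = 2ℓ`, `T' = T` keeps the interval.

## References

* T. Buckmaster, V. Vicol, Ann. of Math. 189 (2019) = arXiv:1709.10033, §4.1 (4.2)–(4.3). [`BuckmasterVicol2019Annals`]
* T. Buckmaster, V. Vicol, EMS Surv. Math. Sci. 6 (2019) = arXiv:1901.09023, §7.3. [`BuckmasterVicol2020`]
-/

noncomputable section

open MeasureTheory TopologicalSpace Set Function Filter Metric ContinuousLinearMap
open _root_.Topology
open scoped ENNReal NNReal Convolution InnerProductSpace ContDiff

namespace Literature.Analysis.FluidPDE

namespace Torus

open FunctionSpaces.Torus (stLift lift kernel IsSmooth IsContDiff IsDivFree HasZeroMean mollifiedField vecMollify)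
open FunctionSpaces (timeAvgWith)

variable {d : Type*} [Fintype d] [DecidableEq d]

/-! ## Small calculus helpers -/

section Helpers

variable {F : Type*} [NormedAddCommGroup F] [NormedSpace ℝ F]

omit [DecidableEq d] in
/-- Composition with an affine time map preserves global joint smoothness. [folklore] -/
theorem isSmoothSpaceTimeOn_comp_affine_of_contDiff {w : ℝ → UnitAddTorus d → F} (hw : ContDiff ℝ ∞ (stLift w))
    (S : Set ℝ) (κ c : ℝ) : FunctionSpaces.Torus.IsSmoothSpaceTimeOn S (fun t => w (κ * t + c)) := by
  have hφ : ContDiff ℝ ∞ (fun z : ℝ × EuclideanSpace ℝ d => (κ * z.1 + c, z.2)) :=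
    ((contDiff_const.mul contDiff_fst).add contDiff_const).prodMk contDiff_snd
  change ContDiffOn ℝ ∞ (stLift w ∘ fun z : ℝ × EuclideanSpace ℝ d => (κ * z.1 + c, z.2)) (S ×ˢ univ)
  exact (hw.comp hφ).contDiffOn

omit [DecidableEq d] in
/-- Composition with an affine time map sending `S'` into `S` preserves joint smoothness. [folklore] -/
theorem isSmoothSpaceTimeOn_comp_affine_of_mapsTo {S S' : Set ℝ} {w : ℝ → UnitAddTorus d → F}
    (hw : FunctionSpaces.Torus.IsSmoothSpaceTimeOn S w) {κ c : ℝ} (hsub : ∀ t ∈ S', κ * t + c ∈ S) :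
    FunctionSpaces.Torus.IsSmoothSpaceTimeOn S' (fun t => w (κ * t + c)) := by
  have hφ : ContDiff ℝ ∞ (fun z : ℝ × EuclideanSpace ℝ d => (κ * z.1 + c, z.2)) :=
    ((contDiff_const.mul contDiff_fst).add contDiff_const).prodMk contDiff_snd
  have hmaps : MapsTo (fun z : ℝ × EuclideanSpace ℝ d => (κ * z.1 + c, z.2)) (S' ×ˢ univ) (S ×ˢ univ) :=
    fun z hz => ⟨hsub z.1 hz.1, mem_univ _⟩
  change ContDiffOn ℝ ∞ (stLift w ∘ fun z : ℝ × EuclideanSpace ℝ d => (κ * z.1 + c, z.2)) (S' ×ˢ univ)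
  exact hw.comp hφ.contDiffOn hmaps

omit [DecidableEq d] in
/-- Chain rule for slices of a globally smooth field along an affine time map. [folklore] -/
theorem hasDerivAt_comp_affine {w : ℝ → UnitAddTorus d → F} (hw : ContDiff ℝ ∞ (stLift w)) (κ c t : ℝ)
    (x : UnitAddTorus d) :
    HasDerivAt (fun s => w (κ * s + c) x) (κ • FunctionSpaces.Torus.timeDeriv w (κ * t + c) x) t := by
  obtain ⟨y, rfl⟩ := FunctionSpaces.Torus.proj_surjective x
  have hdiff : Differentiable ℝ fun s => w s (FunctionSpaces.Torus.proj y) := by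
    have : (fun s => w s (FunctionSpaces.Torus.proj y)) = stLift w ∘ fun s => (s, y) := by funext s; rfl
    rw [this]
    exact (hw.differentiable (by simp)).comp (differentiable_id.prodMk (differentiable_const y))
  have hg : HasDerivAt (fun s => w s (FunctionSpaces.Torus.proj y))
      (FunctionSpaces.Torus.timeDeriv w (κ * t + c) (FunctionSpaces.Torus.proj y)) (κ * t + c) :=
    (hdiff (κ * t + c)).hasDerivAt
  have hf : HasDerivAt (fun s : ℝ => κ * s + c) κ t := by
    simpa using ((hasDerivAt_id t).const_mul κ).add_const c
  exact hg.scomp t hf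

/-- `∫ Δf = 0` over the torus for smooth `f`. [folklore] -/
theorem integral_laplacian_eq_zero_of_smooth {f : UnitAddTorus d → F} [CompleteSpace F] (hf : IsSmooth f) :
    ∫ x, FunctionSpaces.Torus.laplacian f x = 0 := by
  rw [show FunctionSpaces.Torus.laplacian f = fun x => ∑ i, FunctionSpaces.Torus.partialDeriv i (FunctionSpaces.Torus.partialDeriv i f) x
      from funext (FunctionSpaces.Torus.laplacian_eq_sum_partialDeriv_partialDeriv hf),
    integral_finsetSum _ fun i _ => ((hf.partialDeriv i).partialDeriv i).integrable]
  exact Finset.sum_eq_zero fun i _ => FunctionSpaces.Torus.integral_partialDeriv_eq_zero_holds (hf.partialDeriv i) i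

end Helpers

/-! ## The mollified objects of a classical triple -/

section Objects

variable {φ : ContDiffBump (0 : ℝ)} {S : Set ℝ} {ν ε T M A : ℝ} {v : ℝ → UnitAddTorus d → EuclideanSpace ℝ d}
  {p : ℝ → UnitAddTorus d → ℝ} {R : ℝ → UnitAddTorus d → d → EuclideanSpace ℝ d}

/-- **Admissibility of the zero-extended data of a classical triple**: `U = zeroExt T v` and
`RU = zeroExt T R` are strongly measurable, bounded, vanish off the slab; `U` is weakly divergence
free at every time; `U` has zero mean when `v` does; `RU` is symmetric. [folklore] -/
theorem zeroExt_data (h : IsNSReynoldsOn S ν v p R) (hS : Icc 0 T ⊆ S) (hT : 0 < T)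
    (hvb : ∀ s ∈ Icc 0 T, ∀ y, ‖v s y‖ ≤ M) (hRb : ∀ s ∈ Icc 0 T, ∀ y, ‖R s y‖ ≤ A) :
    (StronglyMeasurable (uncurry (zeroExt T v)) ∧ (∀ s y, ‖zeroExt T v s y‖ ≤ M) ∧
      (∀ s, s ∉ Icc 0 T → zeroExt T v s = 0) ∧ (∀ s, FunctionSpaces.Torus.IsWeaklyDivFree (zeroExt T v s))) ∧
    (StronglyMeasurable (uncurry (zeroExt T R)) ∧ (∀ s y, ‖zeroExt T R s y‖ ≤ A) ∧
      (∀ s, s ∉ Icc 0 T → zeroExt T R s = 0) ∧ (∀ s y (i j : d), zeroExt T R s y i j = zeroExt T R s y j i)) := by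
  have hT0 : (0 : ℝ) ≤ T := hT.le
  have hM : 0 ≤ M := (norm_nonneg _).trans (hvb 0 ⟨le_rfl, hT0⟩ 0)
  have hA : 0 ≤ A := (norm_nonneg _).trans (hRb 0 ⟨le_rfl, hT0⟩ 0)
  have hIcc := h.mono_Icc hS hT
  refine ⟨⟨stronglyMeasurable_uncurry_zeroExt hT0 hIcc.smooth_velocity, norm_zeroExt_le hM hvb,
    fun s hs => zeroExt_of_not_mem v hs, fun s => ?_⟩, ⟨stronglyMeasurable_uncurry_zeroExt hT0 hIcc.smooth_stress,
    norm_zeroExt_le hA hRb, fun s hs => zeroExt_of_not_mem R hs, fun s y i j => ?_⟩⟩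
  · by_cases hs : s ∈ Icc 0 T
    · rw [zeroExt_of_mem v hs]
      exact FunctionSpaces.Torus.IsDivFree.isWeaklyDivFree_holds (hIcc.smooth_velocity.isSmooth_slice hs) (hIcc.divFree s hs)
    · rw [zeroExt_of_not_mem v hs]
      exact FunctionSpaces.Torus.IsDivFree.isWeaklyDivFree_holds (FunctionSpaces.Torus.isSmooth_const _)
        (fun x => by simp [FunctionSpaces.Torus.divergence, FunctionSpaces.Torus.partialDeriv, FunctionSpaces.Torus.lineDeriv])
  · by_cases hs : s ∈ Icc 0 T
    · rw [zeroExt_of_mem R hs]; exact hIcc.symm s hs y i j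
    · rw [zeroExt_of_not_mem R hs]; rfl

variable {RU : ℝ → UnitAddTorus d → d → EuclideanSpace ℝ d} {T₀ : ℝ}

omit [DecidableEq d] in
/-- The mollified stress of symmetric data is symmetric. [folklore] -/
theorem mollifiedStress_symm (hRm : StronglyMeasurable (uncurry RU)) (hRb : ∀ s y, ‖RU s y‖ ≤ A)
    (hR0 : ∀ s, s ∉ Icc 0 T₀ → RU s = 0) (hsym : ∀ s y (i j : d), RU s y i j = RU s y j i) (hε : 0 < ε) (hε' : ε ≤ 1 / 4)
    (t : ℝ) (x : UnitAddTorus d) (i j : d) : mollifiedStress φ ε RU t x i j = mollifiedStress φ ε RU t x j i := by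
  have hUi : ∀ k : d, Integrable (uncurry fun s y => RU s y k) ((volume : Measure ℝ).prod volume) := fun k => by
    obtain ⟨hm, hb, h0⟩ := column_data hRm hRb hR0 k
    exact integrable_uncurry_of_bounded hm hb h0
  rw [mollifiedStress_apply, mollifiedStress_apply, mollifiedField_apply_eq_timeAvgWith (hUi i) hε hε',
    mollifiedField_apply_eq_timeAvgWith (hUi j) hε hε']
  congr 1
  funext s
  congr 1
  funext y
  exact hsym s y i j

omit [DecidableEq d] in
/-- The mollified stress is jointly smooth on all of `ℝ × 𝕋^d`, column by column. [folklore] -/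
theorem contDiff_stLift_mollifiedStress_col (hRm : StronglyMeasurable (uncurry RU)) (hRb : ∀ s y, ‖RU s y‖ ≤ A)
    (hR0 : ∀ s, s ∉ Icc 0 T₀ → RU s = 0) (hε : 0 < ε) (hε' : ε ≤ 1 / 4) (j : d) :
    ContDiff ℝ ∞ (stLift fun t x => mollifiedStress φ ε RU t x j) := by
  obtain ⟨hm, hb, h0⟩ := column_data hRm hRb hR0 j
  exact contDiff_stLift_mollifiedField (φ := φ) (integrable_uncurry_of_bounded hm hb h0) hε hε'

end Objects

/-! ## The reparametrised triple -/

section Triple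

variable (φ : ContDiffBump (0 : ℝ)) (ε ν T κ c : ℝ) (v : ℝ → UnitAddTorus d → EuclideanSpace ℝ d)
  (R : ℝ → UnitAddTorus d → d → EuclideanSpace ℝ d)

/-- **The raw stress at slab time `s`**: `V ⊗ V - 𝒯 + ℛ_ℓ` (BV (4.2)–(4.3): `R̊_ℓ + R̃_commutator` before
taking traceless parts). [cite: BuckmasterVicol2019Annals, §4.1 (4.2)–(4.3)] -/
def nsrRaw (s : ℝ) (x : UnitAddTorus d) (j : d) : EuclideanSpace ℝ d :=
  tensorProd (mollifiedField φ ε (zeroExt T v) s) (mollifiedField φ ε (zeroExt T v) s) x j -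
    mollifiedFlux φ ε (zeroExt T v) s x j + mollifiedStress φ ε (zeroExt T R) s x j

/-- **The reparametrised velocity** `ṽ(t) = V(κt + c)`. [cite: BuckmasterVicol2019Annals, §4.1 (4.2)] -/
def reparamVelocity (t : ℝ) : UnitAddTorus d → EuclideanSpace ℝ d :=
  mollifiedField φ ε (zeroExt T v) (κ * t + c)

/-- **The reparametrisation defect** `(κ - 1) ∂ₜV(κt + c)` (zero mean). [folklore] -/
def reparamDefect (t : ℝ) (x : UnitAddTorus d) : EuclideanSpace ℝ d :=
  (κ - 1) • FunctionSpaces.Torus.timeDeriv (mollifiedField φ ε (zeroExt T v)) (κ * t + c) x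

/-- **The reparametrised Reynolds stress** `(V ⊗ V - 𝒯 + ℛ_ℓ)˚(κt + c) + ℛ[(κ - 1)∂ₜV(κt + c)]`.
[cite: BuckmasterVicol2019Annals, §4.1 (4.2)–(4.3)] -/
def reparamStress (t : ℝ) (x : UnitAddTorus d) (j : d) : EuclideanSpace ℝ d :=
  traceless (nsrRaw φ ε T v R (κ * t + c)) x j + antidivergence (reparamDefect φ ε T κ c v t) x j

/-- **The reparametrised pressure** `-q(κt + c) - tr(raw)(κt + c)/d + mean`. [cite: BuckmasterVicol2019Annals, §4.1 (4.3)] -/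
def reparamPressure (q : ℝ → UnitAddTorus d → ℝ) (t : ℝ) (x : UnitAddTorus d) : ℝ :=
  -q (κ * t + c) x - tensorTrace (nsrRaw φ ε T v R (κ * t + c)) x / Fintype.card d +
    ∫ z, tensorTrace (nsrRaw φ ε T v R (κ * t + c)) z / Fintype.card d

end Triple

/-! ## The triple solves the Navier–Stokes–Reynolds system -/

section Main

variable {φ : ContDiffBump (0 : ℝ)} {S : Set ℝ} {ν ε T M A : ℝ} {v : ℝ → UnitAddTorus d → EuclideanSpace ℝ d}
  {p : ℝ → UnitAddTorus d → ℝ} {R : ℝ → UnitAddTorus d → d → EuclideanSpace ℝ d}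

/-- **The residual is jointly smooth and orthogonal to divergence-free fields on the window-interior
times; hence it is a gradient `∇q` there.** [cite: BuckmasterVicol2019Annals, §4.1] -/
theorem exists_pressure_mollifiedNSRResidual (h : IsNSReynoldsOn S ν v p R) (hS : Icc 0 T ⊆ S) (hT : 0 < T)
    (hvb : ∀ s ∈ Icc 0 T, ∀ y, ‖v s y‖ ≤ M) (hRb : ∀ s ∈ Icc 0 T, ∀ y, ‖R s y‖ ≤ A) (hε : 0 < ε) (hε' : ε ≤ 1 / 4) :
    ∃ q : ℝ → UnitAddTorus d → ℝ, FunctionSpaces.Torus.IsSmoothSpaceTimeOn (Ioo φ.rOut (T - φ.rOut)) q ∧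
      (∀ s ∈ Ioo φ.rOut (T - φ.rOut), ∀ x, FunctionSpaces.Torus.gradient (q s) x = mollifiedNSRResidual φ ε ν T v R s x) ∧
      ∀ s ∈ Ioo φ.rOut (T - φ.rOut), HasZeroMean (q s) := by
  obtain ⟨⟨hUm, hUb, hU0, -⟩, ⟨hRUm, hRUb, hRU0, -⟩⟩ := zeroExt_data h hS hT hvb hRb
  set S₀ : Set ℝ := Ioo φ.rOut (T - φ.rOut)
  have hS₀ : IsOpen S₀ := isOpen_Ioo
  have hU' : UniqueDiffOn ℝ S₀ := hS₀.uniqueDiffOn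
  have hUi := integrable_uncurry_of_bounded hUm hUb hU0
  have hV : FunctionSpaces.Torus.IsSmoothSpaceTimeOn S₀ (mollifiedField φ ε (zeroExt T v)) :=
    FunctionSpaces.Torus.isSmoothSpaceTimeOn_of_contDiff (contDiff_stLift_mollifiedField (φ := φ) hUi hε hε') S₀
  have hdV : FunctionSpaces.Torus.IsSmoothSpaceTimeOn S₀ (FunctionSpaces.Torus.timeDeriv (mollifiedField φ ε (zeroExt T v))) :=
    isSmoothSpaceTimeOn_timeDeriv_mollifiedField (φ := φ) hUm hUb hU0 hε hε' S₀
  have hFl : FunctionSpaces.Torus.IsSmoothSpaceTimeOn S₀ (mollifiedFlux φ ε (zeroExt T v)) := by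
    have h' := isSmoothSpaceTimeOn_mollifiedFlux (φ := φ) hUm hUb hU0 hε hε' S₀ 0
    simpa using h'
  have hSt : FunctionSpaces.Torus.IsSmoothSpaceTimeOn S₀ (mollifiedStress φ ε (zeroExt T R)) :=
    isSmoothSpaceTimeOn_tensor_iff.2 fun j =>
      FunctionSpaces.Torus.isSmoothSpaceTimeOn_of_contDiff (contDiff_stLift_mollifiedStress_col (φ := φ) hRUm hRUb hRU0 hε hε' j) S₀
  have hG : FunctionSpaces.Torus.IsSmoothSpaceTimeOn S₀ (mollifiedNSRResidual φ ε ν T v R) :=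
    ((hdV.add (isSmoothSpaceTimeOn_tensorDivergence hFl hU')).sub ((hV.laplacian hU').const_smul ν)).sub
      (isSmoothSpaceTimeOn_tensorDivergence hSt hU')
  refine Torus.exists_smooth_pressure_of_forall_integral_inner_eq_zero hS₀ hG fun s hs w hw hdiv => ?_
  exact integral_inner_mollifiedNSRResidual_eq_zero h hS hT hvb hRb hε hε' hs.1 (by linarith [hs.2]) hw hdiv

/-- **The reparametrised mollification solves the Navier–Stokes–Reynolds system.** Let `(v, p, R)`
solve the NSR system with viscosity `ν` on `S ⊇ [0, T]` (`T > 0`, `d ≥ 2`), with sup bounds on the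
slab; let `0 < ε ≤ 1/4`, let `q` be the pressure of the residual on the
window-interior times `S₀ = (rOut, T - rOut)` (`Torus.exists_pressure_mollifiedNSRResidual`), and let
`τ(t) = κt + c` map `[0, T']` into `S₀`. Then `(reparamVelocity, reparamPressure q, reparamStress)` solves
the NSR system with viscosity `ν` on `[0, T'] × 𝕋^d`. [cite: BuckmasterVicol2019Annals, §4.1 (4.2)–(4.3)] -/
theorem isNSReynoldsOn_reparam (hd : 2 ≤ Fintype.card d) (h : IsNSReynoldsOn S ν v p R) (hS : Icc 0 T ⊆ S) (hT : 0 < T)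
    (hvb : ∀ s ∈ Icc 0 T, ∀ y, ‖v s y‖ ≤ M) (hRb : ∀ s ∈ Icc 0 T, ∀ y, ‖R s y‖ ≤ A)
    (hε : 0 < ε) (hε' : ε ≤ 1 / 4)
    {q : ℝ → UnitAddTorus d → ℝ} (hq : FunctionSpaces.Torus.IsSmoothSpaceTimeOn (Ioo φ.rOut (T - φ.rOut)) q)
    (hgrad : ∀ s ∈ Ioo φ.rOut (T - φ.rOut), ∀ x, FunctionSpaces.Torus.gradient (q s) x = mollifiedNSRResidual φ ε ν T v R s x)
    (hqmean : ∀ s ∈ Ioo φ.rOut (T - φ.rOut), HasZeroMean (q s))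
    {κ c T' : ℝ} (hT' : 0 < T') (hwin : ∀ t ∈ Icc 0 T', κ * t + c ∈ Ioo φ.rOut (T - φ.rOut)) :
    IsNSReynoldsOn (Icc 0 T') ν (reparamVelocity φ ε T κ c v) (reparamPressure φ ε T κ c v R q) (reparamStress φ ε T κ c v R) := by
  haveI : Nonempty d := Fintype.card_pos_iff.1 (by omega)
  obtain ⟨⟨hUm, hUb, hU0, hUdiv⟩, ⟨hRUm, hRUb, hRU0, hRUsym⟩⟩ := zeroExt_data h hS hT hvb hRb
  set U := zeroExt T v with hUdef
  set RU := zeroExt T R with hRUdef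
  set S₀ : Set ℝ := Ioo φ.rOut (T - φ.rOut) with hS₀def
  have hUi := integrable_uncurry_of_bounded hUm hUb hU0
  have hU' : UniqueDiffOn ℝ (Icc 0 T') := uniqueDiffOn_Icc hT'
  have hcv : Convex ℝ (Icc 0 T') := convex_Icc 0 T'
  have hint : (interior (Icc 0 T')).Nonempty := by rw [interior_Icc]; exact nonempty_Ioo.2 hT'
  have hVg : ContDiff ℝ ∞ (stLift (mollifiedField φ ε U)) := contDiff_stLift_mollifiedField (φ := φ) hUi hε hε'
  have hdVg : ContDiff ℝ ∞ (stLift (FunctionSpaces.Torus.timeDeriv (mollifiedField φ ε U))) :=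
    (isSpaceTimeTest_mollifiedField (φ := φ) hUi hε hε' hU0).timeDeriv.1
  have hFlg : ∀ j, ContDiff ℝ ∞ (stLift fun t x => mollifiedFlux φ ε U t x j) := fun j =>
    contDiff_stLift_mollifiedField (φ := φ) (integrable_uncurry_smul_apply hUm hUb hU0 j) hε hε'
  have hStg : ∀ j, ContDiff ℝ ∞ (stLift fun t x => mollifiedStress φ ε RU t x j) := fun j =>
    contDiff_stLift_mollifiedStress_col (φ := φ) hRUm hRUb hRU0 hε hε' j
  -- smoothness of the reparametrised pieces on `[0, T']`
  have hV : FunctionSpaces.Torus.IsSmoothSpaceTimeOn (Icc 0 T') (reparamVelocity φ ε T κ c v) :=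
    isSmoothSpaceTimeOn_comp_affine_of_contDiff hVg _ κ c
  have hdV : FunctionSpaces.Torus.IsSmoothSpaceTimeOn (Icc 0 T')
      (fun t => FunctionSpaces.Torus.timeDeriv (mollifiedField φ ε U) (κ * t + c)) :=
    isSmoothSpaceTimeOn_comp_affine_of_contDiff hdVg _ κ c
  have hFl : FunctionSpaces.Torus.IsSmoothSpaceTimeOn (Icc 0 T') (fun t => mollifiedFlux φ ε U (κ * t + c)) :=
    isSmoothSpaceTimeOn_tensor_iff.2 fun j => isSmoothSpaceTimeOn_comp_affine_of_contDiff (hFlg j) _ κ c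
  have hSt : FunctionSpaces.Torus.IsSmoothSpaceTimeOn (Icc 0 T') (fun t => mollifiedStress φ ε RU (κ * t + c)) :=
    isSmoothSpaceTimeOn_tensor_iff.2 fun j => isSmoothSpaceTimeOn_comp_affine_of_contDiff (hStg j) _ κ c
  have hraw : FunctionSpaces.Torus.IsSmoothSpaceTimeOn (Icc 0 T') (fun t => nsrRaw φ ε T v R (κ * t + c)) :=
    ((hV.tensorProd hV).sub hFl).add hSt
  have hdef : FunctionSpaces.Torus.IsSmoothSpaceTimeOn (Icc 0 T') (reparamDefect φ ε T κ c v) := hdV.const_smul (κ - 1)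
  have hq' : FunctionSpaces.Torus.IsSmoothSpaceTimeOn (Icc 0 T') (fun t => q (κ * t + c)) :=
    isSmoothSpaceTimeOn_comp_affine_of_mapsTo hq hwin
  have hθ : FunctionSpaces.Torus.IsSmoothSpaceTimeOn (Icc 0 T')
      (fun t x => tensorTrace (nsrRaw φ ε T v R (κ * t + c)) x / Fintype.card d) :=
    ContDiffOn.div_const hraw.tensorTrace _
  -- slice facts at slab time `s`
  have hVs : ∀ s, IsSmooth (mollifiedField φ ε U s) := fun s => isSmooth_mollifiedField hUi hε hε' s
  have hVdiv : ∀ s, IsDivFree (mollifiedField φ ε U s) := fun s =>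
    isDivFree_mollifiedField hUi (Eventually.of_forall hUdiv) hε hε' s
  have hTs : ∀ s, IsSmooth (mollifiedFlux φ ε U s) := fun s => isSmooth_mollifiedFlux (φ := φ) hUm hUb hU0 hε hε' s
  have hSts : ∀ s, IsSmooth (mollifiedStress φ ε RU s) := fun s => isSmooth_mollifiedStress (φ := φ) hRUm hRUb hRU0 hε hε' s
  have hraws : ∀ s, IsSmooth (nsrRaw φ ε T v R s) := fun s => (((hVs s).tensorProd (hVs s)).sub (hTs s)).add (hSts s)
  have hdVs : ∀ s, IsSmooth (FunctionSpaces.Torus.timeDeriv (mollifiedField φ ε U) s) := fun s =>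
    (FunctionSpaces.Torus.isSmoothSpaceTimeOn_of_contDiff hdVg univ).isSmooth_slice (mem_univ s)
  -- zero mean of `∂ₜV(s)` for `s ∈ S₀`, from the residual identity
  have hdVmean : ∀ s ∈ S₀, ∫ x, FunctionSpaces.Torus.timeDeriv (mollifiedField φ ε U) s x = 0 := by
    intro s hs
    have hqs : IsSmooth (q s) := hq.isSmooth_slice hs
    have e : FunctionSpaces.Torus.timeDeriv (mollifiedField φ ε U) s = fun x => FunctionSpaces.Torus.gradient (q s) x -
        tensorDivergence (mollifiedFlux φ ε U s) x + ν • FunctionSpaces.Torus.laplacian (mollifiedField φ ε U s) x +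
        tensorDivergence (mollifiedStress φ ε RU s) x := by
      funext x
      have hg := hgrad s hs x
      simp only [mollifiedNSRResidual, mollifiedEulerResidual_apply, ← hUdef, ← hRUdef] at hg
      rw [hg]; abel
    have i1 : Integrable (FunctionSpaces.Torus.gradient (q s)) volume := hqs.gradient.integrable
    have i2 : Integrable (tensorDivergence (mollifiedFlux φ ε U s)) volume := (hTs s).tensorDivergence.integrable
    have i3 : Integrable (fun x => ν • FunctionSpaces.Torus.laplacian (mollifiedField φ ε U s) x) volume :=
      (hVs s).laplacian.integrable.smul ν
    have i4 : Integrable (tensorDivergence (mollifiedStress φ ε RU s)) volume := (hSts s).tensorDivergence.integrable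
    have i12 : Integrable (fun x => FunctionSpaces.Torus.gradient (q s) x - tensorDivergence (mollifiedFlux φ ε U s) x) volume := i1.sub i2
    have i123 : Integrable (fun x => FunctionSpaces.Torus.gradient (q s) x - tensorDivergence (mollifiedFlux φ ε U s) x +
        ν • FunctionSpaces.Torus.laplacian (mollifiedField φ ε U s) x) volume := i12.add i3
    rw [e, integral_add i123 i4, integral_add i12 i3, integral_sub i1 i2, integral_smul,
      FunctionSpaces.Torus.integral_gradient_eq_zero hqs, integral_tensorDivergence_eq_zero' (hTs s),
      integral_laplacian_eq_zero_of_smooth (hVs s), integral_tensorDivergence_eq_zero' (hSts s)]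
    simp
  have hdefmean : ∀ t ∈ Icc 0 T', ∫ x, reparamDefect φ ε T κ c v t x = 0 := fun t ht => by
    simp only [reparamDefect]
    rw [integral_smul, ← hUdef, hdVmean _ (hwin t ht), smul_zero]
  refine
    { smooth_velocity := hV
      smooth_pressure := (hq'.neg.sub hθ).add (hθ.integral_const hU' hcv)
      smooth_stress := hraw.traceless.add (hdef.antidivergence hcv hint)
      momentum := fun t ht x => ?_
      divFree := fun t _ => hVdiv _
      symm := fun t ht x i j => ?_
      traceFree := fun t ht x => ?_
      hasZeroMean_pressure := fun t ht => ?_ }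
  · -- momentum at slab time `s = κt + c`
    set s := κ * t + c with hsdef
    have hsS : s ∈ S₀ := hwin t ht
    have hqs : IsSmooth (q s) := hq.isSmooth_slice hsS
    -- (1) time derivative with the defect
    have h1 : FunctionSpaces.Torus.timeDerivWithin (Icc 0 T') (reparamVelocity φ ε T κ c v) t x =
        FunctionSpaces.Torus.timeDeriv (mollifiedField φ ε U) s x + reparamDefect φ ε T κ c v t x := by
      have hψ : ContDiff ℝ ∞ (stLift (reparamVelocity φ ε T κ c v)) := by
        have hφ : ContDiff ℝ ∞ (fun z : ℝ × EuclideanSpace ℝ d => (κ * z.1 + c, z.2)) :=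
          ((contDiff_const.mul contDiff_fst).add contDiff_const).prodMk contDiff_snd
        change ContDiff ℝ ∞ (stLift (mollifiedField φ ε U) ∘ fun z : ℝ × EuclideanSpace ℝ d => (κ * z.1 + c, z.2))
        exact hVg.comp hφ
      rw [FunctionSpaces.Torus.timeDerivWithin_eq_timeDeriv_of_contDiff hψ hU' ht x, FunctionSpaces.Torus.timeDeriv,
        show (fun s' => reparamVelocity φ ε T κ c v s' x) = fun s' => mollifiedField φ ε U (κ * s' + c) x from rfl,
        (hasDerivAt_comp_affine hVg κ c t x).deriv]
      simp only [reparamDefect, ← hsdef, ← hUdef, sub_smul, one_smul]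
      abel
    -- (2) the convective term
    have h2 : FunctionSpaces.Torus.convect (mollifiedField φ ε U s) (mollifiedField φ ε U s) x =
        tensorDivergence (tensorProd (mollifiedField φ ε U s) (mollifiedField φ ε U s)) x := by
      rw [tensorDivergence_tensorProd (hVs s) (hVs s), hVdiv s x, zero_smul, add_zero]
    -- (3) the divergence of the stress
    have h3 : tensorDivergence (reparamStress φ ε T κ c v R t) x =
        tensorDivergence (nsrRaw φ ε T v R s) x -
          FunctionSpaces.Torus.gradient (fun y => tensorTrace (nsrRaw φ ε T v R s) y / Fintype.card d) x +
          reparamDefect φ ε T κ c v t x := by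
      have hA : IsSmooth (traceless (nsrRaw φ ε T v R s)) := (hraws s).traceless
      have hB : IsSmooth (antidivergence (reparamDefect φ ε T κ c v t)) := isSmooth_antidivergence (hdef.isSmooth_slice ht)
      change tensorDivergence (fun y j => traceless (nsrRaw φ ε T v R s) y j + antidivergence (reparamDefect φ ε T κ c v t) y j) x = _
      rw [tensorDivergence_add_apply (hA.isContDiff (by simp)) (hB.isContDiff (by simp)), tensorDivergence_traceless (hraws s),
        tensorDivergence_antidivergence hd (hdef.isSmooth_slice ht) x, hdefmean t ht, sub_zero]
    have h4 : tensorDivergence (nsrRaw φ ε T v R s) x =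
        tensorDivergence (tensorProd (mollifiedField φ ε U s) (mollifiedField φ ε U s)) x -
          tensorDivergence (mollifiedFlux φ ε U s) x + tensorDivergence (mollifiedStress φ ε RU s) x := by
      have hA : IsSmooth fun y j => tensorProd (mollifiedField φ ε U s) (mollifiedField φ ε U s) y j - mollifiedFlux φ ε U s y j :=
        isSmooth_tensor fun j => (((hVs s).tensorProd (hVs s)).column j).sub ((hTs s).column j)
      change tensorDivergence (fun y j => (tensorProd (mollifiedField φ ε U s) (mollifiedField φ ε U s) y j -
        mollifiedFlux φ ε U s y j) + mollifiedStress φ ε RU s y j) x = _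
      rw [tensorDivergence_add_apply (hA.isContDiff (by simp)) ((hSts s).isContDiff (by simp)),
        tensorDivergence_sub ((hVs s).tensorProd (hVs s)) (hTs s) x]
    -- (4) the pressure gradient
    have h5 : FunctionSpaces.Torus.gradient (reparamPressure φ ε T κ c v R q t) x =
        -(FunctionSpaces.Torus.gradient (q s) x) -
          FunctionSpaces.Torus.gradient (fun y => tensorTrace (nsrRaw φ ε T v R s) y / Fintype.card d) x := by
      have hθs : IsSmooth fun y => tensorTrace (nsrRaw φ ε T v R s) y / Fintype.card d := ContDiff.div_const (hraws s).tensorTrace _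
      change FunctionSpaces.Torus.gradient (fun y => -q s y - tensorTrace (nsrRaw φ ε T v R s) y / Fintype.card d +
        ∫ z, tensorTrace (nsrRaw φ ε T v R s) z / Fintype.card d) x = _
      rw [gradient_add_const']
      have hneg : (fun y => -q s y - tensorTrace (nsrRaw φ ε T v R s) y / Fintype.card d) =
          fun y => (-1) * q s y + (-1) * (tensorTrace (nsrRaw φ ε T v R s) y / Fintype.card d) := by
        funext y; ring
      have h1c : IsContDiff 1 (fun y => (-1) * q s y) := by
        show ContDiff ℝ 1 (fun z => (-1) * lift (q s) z)
        exact contDiff_const.mul (hqs.isContDiff (by simp))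
      have h2c : IsContDiff 1 (fun y => (-1) * (tensorTrace (nsrRaw φ ε T v R s) y / Fintype.card d)) := by
        show ContDiff ℝ 1 (fun z => (-1) * lift (fun y => tensorTrace (nsrRaw φ ε T v R s) y / Fintype.card d) z)
        exact contDiff_const.mul (hθs.isContDiff (by simp))
      rw [hneg, gradient_add_apply h1c h2c, gradient_const_mul_apply (hqs.isContDiff (by simp)),
        gradient_const_mul_apply (hθs.isContDiff (by simp))]
      simp only [neg_smul, one_smul]
      abel
    -- the residual identity at `s`
    have hres : FunctionSpaces.Torus.gradient (q s) x = FunctionSpaces.Torus.timeDeriv (mollifiedField φ ε U) s x +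
        tensorDivergence (mollifiedFlux φ ε U s) x - ν • FunctionSpaces.Torus.laplacian (mollifiedField φ ε U s) x -
        tensorDivergence (mollifiedStress φ ε RU s) x := by
      rw [hgrad s hsS x]; rfl
    -- assemble
    show FunctionSpaces.Torus.timeDerivWithin (Icc 0 T') (reparamVelocity φ ε T κ c v) t x +
        FunctionSpaces.Torus.convect (mollifiedField φ ε U s) (mollifiedField φ ε U s) x +
        FunctionSpaces.Torus.gradient (reparamPressure φ ε T κ c v R q t) x =
      ν • FunctionSpaces.Torus.laplacian (mollifiedField φ ε U s) x + tensorDivergence (reparamStress φ ε T κ c v R t) x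
    rw [h1, h2, h5, h3, h4, hres]
    abel
  · -- symmetry
    set s := κ * t + c
    have e1 : tensorProd (mollifiedField φ ε U s) (mollifiedField φ ε U s) x i j =
        tensorProd (mollifiedField φ ε U s) (mollifiedField φ ε U s) x j i := by
      simp only [tensorProd, PiLp.smul_apply, smul_eq_mul]; ring
    have hrsym : ∀ i j, nsrRaw φ ε T v R s x i j = nsrRaw φ ε T v R s x j i := fun i j => by
      simp only [nsrRaw, PiLp.add_apply, PiLp.sub_apply, ← hUdef, ← hRUdef]
      rw [mollifiedFlux_symm (φ := φ) hUm hUb hU0 hε hε' s x i j, mollifiedStress_symm (φ := φ) hRUm hRUb hRU0 hRUsym hε hε' s x i j]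
      simp only [tensorProd, PiLp.smul_apply, smul_eq_mul]; ring
    simp only [reparamStress, PiLp.add_apply]
    rw [traceless_symm (fun i j => hrsym i j) i j, antidivergence_symm (hdef.isSmooth_slice ht) x i j]
  · -- trace
    simp only [reparamStress, PiLp.add_apply, Finset.sum_add_distrib, sum_traceless_apply_apply,
      antidivergence_trace hd (hdef.isSmooth_slice ht), add_zero]
  · -- zero mean of the pressure
    set s := κ * t + c with hsdef
    have hsS : s ∈ S₀ := hwin t ht
    have hqi : Integrable (q s) volume := (hq.isSmooth_slice hsS).continuous.integrable_unitAddTorus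
    have hθs : IsSmooth fun y => tensorTrace (nsrRaw φ ε T v R s) y / Fintype.card d := ContDiff.div_const (hraws s).tensorTrace _
    have hθi : Integrable (fun y => tensorTrace (nsrRaw φ ε T v R s) y / Fintype.card d) volume := hθs.continuous.integrable_unitAddTorus
    have hq0 : ∫ x, q s x = 0 := hqmean s hsS
    show ∫ x, (-q s x - tensorTrace (nsrRaw φ ε T v R s) x / Fintype.card d +
      ∫ z, tensorTrace (nsrRaw φ ε T v R s) z / Fintype.card d) = 0
    have hqn : Integrable (fun x => -q s x) volume := hqi.neg
    have hqs' : Integrable (fun x => -q s x - tensorTrace (nsrRaw φ ε T v R s) x / Fintype.card d) volume := hqn.sub hθi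
    rw [integral_add hqs' (integrable_const _), integral_sub hqn hθi, integral_neg, hq0,
      MeasureTheory.integral_const, smul_eq_mul, probReal_univ]
    ring

end Main

end Torus

end Literature.Analysis.FluidPDE
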